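/-
Copyright (c) 2026 the pub-hodgecm-mathlib formalisation cell (harness21).  Prover seat hodgecm-mathlib-K2E3-p03 (g0), HCML Track B «K2-LIT», line lead of U3-d
`sig_K2E3ShalikaGermHomogeneityRay`; RUNG 2 of MEMO-3H-roads (road H-a′, step (G3)): `‹Ψ-package› → ‹#3H*›`.
-/
import Summits.HodgeConjecture.HodgeConjecture.Theorems.K2E3ShalikaGermHomogeneityRayOfReference    -- ★ p855211 (this seat): `sum_mul_eq_single_of_dual`, the ‹#3H*› text; brings `charpoly_out_mk`, `isRegularElt_out_mk`, ★ DUAL, ★ Rao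
import Summits.HodgeConjecture.HodgeConjecture.Theorems.K2E3CompactCartanRegularRay              -- ★ p855173 (K2E3-p01): `compactCartanRegularRay` (a regular sequence of `T` tending to `1`)
import Literature.NumberTheory.Rogawski1990.ShalikaGermExpansionUnitaryThreeNonsplitCM           -- ★ the Howe-road germ expansion `UnitaryGroup.shalikaGermExpansionNonsplit_antidiagOne_three`
import Literature.NumberTheory.Rogawski1990.LocalCentralizerTorusMeasureCM                       -- ★ `exists_isHaarMeasure_isInvInvariant_compactCore_eq_one_G` (the normalised torus measure on `Z(γ)`)
import Literature.NumberTheory.Automorphic.OrbitalIntegralLocallyConstantChart                    -- ★ `IsCanonical.classOrbitalIntegral_mk_eq_integral_descConj` (the canonical orbital integral read over `G ⧸ Z(γ)`)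
import Literature.NumberTheory.Automorphic.LocalUnitaryGroupCongr                                 -- ★ `antidiagOne_isHermitian`, `isUnit_antidiagOne_det`
import HarnessLib

/-!
# K2 · E3 — `Theorems/K2E3ShalikaGermHomogeneityOfUnipotentScaling.lean`: HOMOGENEITY OF THE SHALIKA GERMS ON A RAY FROM AN EQUIVARIANT CONTRACTION THAT
# SCALES THE UNIPOTENT ORBITAL INTEGRALS (road H-a′ of the U3-d line: Harish-Chandra's homogeneity ON THE GROUP; Rogawski 1990 Prop. 8.1.2 (b), HC 1999 Thm. 8.1 (1), L. 3.2)

HCML Track B «K2-LIT», cell `pub/hodgecm-mathlib`, crux H413 = `stmt-HodgeConjecture-24833` (lane `--supports … --as helper`); seat `hodgecm-mathlib-K2E3-p03` (g0), LINE LEAD of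
U3-d (`Cruxes/H413/Lines/K2_E3_EllipticInputsSigs_U3CubicGerms.lean` ED. 2 :101).  RUNG 2 of `K2/K2E3-p03/g0/MEMO-3H-roads.K2E3-p03-g0.md` ADDENDUM 1 (road H-a′): step (G3)
«homogeneity of the Howe germs from (G1) an Ad-equivariant contraction `Ψ` of a neighbourhood of the unipotent variety + (G2) the scaling of the unipotent orbital integrals
under `Ψ`», delivering the `∃`-form ‹#3H*› of U3-d (★ p855211 turns ‹#3H*› into U3-d, ★ p855129 turns U3-d into socket #3).

THE STATEMENT `shalikaGermHomogeneityRayRef_of_unipotentScaling : ‹Ψ-package› → ‹#3H*›`.  ‹#3H*› = the hypothesis of ★ p855211 TOKEN FOR TOKEN.  ‹Ψ-package› (for every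
CM `L`, non-split `v`, σ-algebras): there are a self-map `Ψ` of `G = U(Φ₃)(L⁺_v)`, a set `U₀`, `q ∈ ℂ` and exponents `a : ConjClasses G → ℕ` with (U1) `U₀ ∈ 𝓝 1`, (U2) `U₀`
is `Ad`-stable, (E) `Ψ(xγx⁻¹) = xΨ(γ)x⁻¹` on `U₀`, (Z) `z` commutes with `γ ∈ U₀` iff it commutes with `Ψγ`, (R) `Ψ` preserves regularity on `U₀`, (C) `Ψ U₀ ⊆ U₀`, (T) `Ψ^k γ → 1`
for `γ ∈ U₀`, (S) `1_{U₀}·(F ∘ Ψ) ∈ C_c^∞` for `F ∈ C_c^∞`, (Q) `‖q‖ > 1`, `a u ≥ 1` off the identity class, and (SC) THE SCALING OF UNIPOTENT ORBITAL INTEGRALS: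
`Φ_{mU}(u, 1_{U₀}·(F∘Ψ)) = q^{a u}·Φ_{mU}(u, F)` for every finite set `S` of unipotent classes, every `mU` admissible on `S`, `u ∈ S`, `F ∈ C_c^∞`.  In print `Ψ` is the Cayley
scaling `c ∘ (ϖ²·) ∘ c⁻¹` (Ad-equivariant; `Z(Ψγ) = Z(γ)` as `Ψγ ∈ F[γ]` and back; each unipotent class is mapped into itself because `ϖ² = N_{E∕F}(ϖ)`; `Ψ^k(c X₀) =
c(ϖ^{2k}X₀)` is ★ `K2E3CompactCartanRegularRay`'s ray), `q = q_F`, `a u = d(u) = dim G∕G_u ∈ {4, 6}` [HarishChandra1999, L. 3.2; Rogawski1990, Prop. 8.1.2 (b)]; (G1) = (U1)–(S)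
is algebra over ★ `F0P3cStCharTSCayleyUnitary`, (G2) = (SC) is the XL input of the line.

THE MATHEMATICS (step (G3), all other inputs ★).  Take the Howe expansion datum `(S*, mU*, Γ*)` of ★ `shalikaGermExpansionNonsplit_antidiagOne_three` for the canonical
family and its ★ DUAL pieces `φ_u` (Rao by the datum).  For `γ ∈ U₀` regular with `charpoly` close to `(X − 1)³` (three neighbourhoods: the datum's for `φ_u`, for
`1_{U₀}·(φ_u∘Ψ)`, and the `Ψ`-image condition — all eventually met along `Ψ^k γₛ → 1`):
`Γ*_u([Ψγ]) = Φ([Ψγ], φ_u)` (duality) `= ∫_{G⧸Z(γ)} φ_u(xΨγx⁻¹)` (★ `IsCanonical.classOrbitalIntegral_mk_eq_integral_descConj` with `Z(Ψγ) = Z(γ)`, (Z); the normalised torus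
measure ★ `exists_isHaarMeasure_isInvInvariant_compactCore_eq_one_G`) `= ∫_{G⧸Z(γ)} (1_{U₀}·(φ_u∘Ψ))(xγx⁻¹)` ((E), (U2)) `= Φ([γ], 1_{U₀}·(φ_u∘Ψ)) = Σ_{u′} Φ_{U*}(u′, 1_{U₀}·(φ_u∘Ψ))
Γ*_{u′}([γ])` (the datum at the ★-smooth (S) function) `= Σ_{u′} q^{a u′} Φ_{U*}(u′, φ_u) Γ*_{u′}([γ])` ((SC)) `= q^{a u} Γ*_u([γ])` (duality).  The ray: `γₛ ∈ T ∩ U₀` regular (★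
`compactCartanRegularRay` enters `U₀`), `γ_n := Ψ^{n+k₀} γₛ` stays in `T` ((Z) with `z = γ₀`), regular ((R)), tends to `1` ((T)), and from `k₀` on every `γ_n` lies in the three
neighbourhoods, so `Γ*_u([γ_{n+1}]) = q^{a u} Γ*_u([γ_n])`, i.e. `Γ*_u([γ_n]) = q^{n·a u}·Γ*_u([γ_0])` — ‹#3H*› with `n₀ = 0`.

HONEST LABEL: count-neutral helper (U3-d stays OPEN; with ★ p855211∕p855129 the socket chain #3 ⟸ U3-d ⟸ ‹#3H*› ⟸ ‹Ψ-package› is ★, and ‹Ψ-package› = (G1) algebra + (G2) the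
scaling constants `q_F^{d(u)}` of the unipotent orbital integrals — the remaining XL letter of row #3); HC_CM is proved only modulo the 7 printed citations (2 remaining named
inputs: hLiu418 = `stmt-HodgeConjecture-24832`, h413 = `stmt-HodgeConjecture-24833`) until rung 0 closes.  No `sorry`, axioms ⊆ the trio, no `def`, no instance, no notation.

## References
* [Rogawski1990] J. D. Rogawski, *Automorphic Representations of Unitary Groups in Three Variables*, Ann. of Math. Stud. 123 (1990): §8.1 Prop. 8.1.1 pp. 112–113, Prop. 8.1.2 (b)
  p. 114 (homogeneity along `exp(t²Y)`), (8.1.1) p. 116.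
* [HarishChandra1999AdmissibleDistributions] Harish-Chandra (DeBacker–Sally notes), AMS ULS 16 (1999): §3.1 Lemma 3.2 (homogeneity of nilpotent orbital integrals), Thm. 8.1 (1).
* [DeitmarEchterhoff2014] A. Deitmar, S. Echterhoff, *Principles of Harmonic Analysis* (2014), Thm. 1.5.3 (the quotient measure).
-/

set_option autoImplicit false
-- the mandated namespace has the single-problem summit's repeated segment (`HodgeConjecture.HodgeConjecture`)
set_option linter.dupNamespace false

noncomputable section

open NumberField IsDedekindDomain MeasureTheory Filter Topology
open scoped Matrix MatrixGroups Valued NNReal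
open Literature.NumberTheory.Rogawski1990 Literature.NumberTheory.Automorphic Literature.NumberTheory.Automorphic.UnitaryGroup
open Literature.MeasureTheory.Group
open Summit.HodgeConjecture.HodgeConjecture.Cruxes.H413.K2E3GermResidueAtCubicTorusOfHomogeneity
open Summit.HodgeConjecture.HodgeConjecture.Cruxes.H413.K2E3ShalikaGermHomogeneityRayOfReference
open Summit.HodgeConjecture.HodgeConjecture.Cruxes.H413.K2E3CompactCartanRegularRay

namespace Summit.HodgeConjecture.HodgeConjecture.Cruxes.H413.K2E3ShalikaGermHomogeneityOfUnipotentScaling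

variable (L : Type) [Field L] [NumberField L] [IsCMField L] (v : HeightOneSpectrum (𝓞 ↥(maximalRealSubfield L)))

/-! ## §1 Small facts -/

/-- Regularity is a class function on `U(Φ₃)(L⁺_v)` (★ `isRegularElt_conj_iff` read through the subgroup coercion). [cite: Rogawski1990, §3.1 p. 19] -/
theorem isRegularElt_conj (g x : Gqs L v) (hg : IsRegularElt (g.val : GL (Fin 3) (UnitaryGroup.LocalRing L v))) :
    IsRegularElt ((x * g * x⁻¹ : Gqs L v).val : GL (Fin 3) (UnitaryGroup.LocalRing L v)) := by
  have h : ((x * g * x⁻¹ : Gqs L v).val : GL (Fin 3) (UnitaryGroup.LocalRing L v)) = x.val * g.val * x.val⁻¹ := rfl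
  rw [h]
  exact (isRegularElt_conj_iff x.val g.val).2 hg

/-- Iterates of a self-map preserving a set stay in the set. [folklore] -/
theorem iterate_mem {α : Type*} {Ψ : α → α} {U : Set α} (hC : ∀ γ ∈ U, Ψ γ ∈ U) {γ : α} (hγ : γ ∈ U) (k : ℕ) : Ψ^[k] γ ∈ U := by
  induction k with
  | zero => exact hγ
  | succ k ih => rw [Function.iterate_succ_apply']; exact hC _ ih

/-- A geometric recursion: `s (k+1) = r · s k` for all `k` gives `s k = r^k · s 0`. [folklore] -/
theorem eq_pow_mul_of_succ_eq_mul {s : ℕ → ℂ} {r : ℂ} (h : ∀ k, s (k + 1) = r * s k) (k : ℕ) : s k = r ^ k * s 0 := by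
  induction k with
  | zero => rw [pow_zero, one_mul]
  | succ k ih => rw [h k, ih, pow_succ]; ring

/-! ## §2 THE HEAD: `‹Ψ-package› → ‹#3H*›` -/

set_option maxHeartbeats 3200000 in  -- statement-level `whnf` on the CM carriers (the U3 socket frame, twice)
set_option synthInstance.maxHeartbeats 400000 in  -- idem
open scoped Classical in
/-- **HOMOGENEITY OF THE SHALIKA GERMS ON A RAY FROM AN EQUIVARIANT CONTRACTION SCALING THE UNIPOTENT ORBITAL INTEGRALS: `‹Ψ-package› → ‹#3H*›`** (road H-a′, step (G3);
conclusion = the hypothesis of ★ p855211 token for token).  See the module docstring for the hypotheses (U1)–(SC) and the proof.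
[cite: Rogawski1990, §8.1 Prop. 8.1.1 pp. 112–113; Prop. 8.1.2 (b) p. 114] [cite: HarishChandra1999AdmissibleDistributions, §3.1 Lemma 3.2; Thm. 8.1 p. 48]
[cite: DeitmarEchterhoff2014, Thm. 1.5.3] -/
theorem shalikaGermHomogeneityRayRef_of_unipotentScaling
    (hΨ :
      ∀ (L : Type) [Field L] [NumberField L] [IsCMField L] (v : HeightOneSpectrum (𝓞 ↥(maximalRealSubfield L))),
        (∀ w : PlacesOver L v, IsCMField.complexConj L • w.1 = w.1) →
        ∀ [MeasurableSpace (Gqs L v)] [BorelSpace (Gqs L v)]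
          [∀ γ : Gqs L v, MeasurableSpace (Gqs L v ⧸ Subgroup.centralizer ({γ} : Set (Gqs L v)))]
          [∀ γ : Gqs L v, BorelSpace (Gqs L v ⧸ Subgroup.centralizer ({γ} : Set (Gqs L v)))],
        ∃ (Ψ : Gqs L v → Gqs L v) (U₀ : Set (Gqs L v)) (q : ℂ) (a : ConjClasses (Gqs L v) → ℕ),
          U₀ ∈ 𝓝 (1 : Gqs L v) ∧
          (∀ γ ∈ U₀, ∀ x : Gqs L v, x * γ * x⁻¹ ∈ U₀) ∧
          (∀ γ ∈ U₀, ∀ x : Gqs L v, Ψ (x * γ * x⁻¹) = x * Ψ γ * x⁻¹) ∧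
          (∀ γ ∈ U₀, ∀ z : Gqs L v, z * γ = γ * z ↔ z * Ψ γ = Ψ γ * z) ∧
          (∀ γ ∈ U₀, IsRegularElt (γ.val : GL (Fin 3) (UnitaryGroup.LocalRing L v)) → IsRegularElt ((Ψ γ).val : GL (Fin 3) (UnitaryGroup.LocalRing L v))) ∧
          (∀ γ ∈ U₀, Ψ γ ∈ U₀) ∧
          (∀ γ ∈ U₀, Tendsto (fun k : ℕ => Ψ^[k] γ) atTop (𝓝 (1 : Gqs L v))) ∧
          (∀ F : Gqs L v → ℂ, IsLocSmooth F → IsLocSmooth (U₀.indicator (F ∘ Ψ))) ∧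
          1 < ‖q‖ ∧
          (∀ u : ConjClasses (Gqs L v), u ≠ ConjClasses.mk 1 → 1 ≤ a u) ∧
          ∀ (S : Finset (ConjClasses (Gqs L v))) (mU : OrbitalMeasureFamily (Gqs L v)),
            (∀ u ∈ S, (((Quotient.out u : Gqs L v).val : GL (Fin 3) (UnitaryGroup.LocalRing L v)).val - 1) ^ 3 = 0) →
            mU.IsAdmissibleOn (fun γ : Gqs L v => (ConjClasses.mk γ) ∈ S) →
            ∀ u ∈ S, ∀ F : Gqs L v → ℂ, IsLocSmooth F →
              classOrbitalIntegral mU (U₀.indicator (F ∘ Ψ)) u = q ^ (a u) * classOrbitalIntegral mU F u) :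
    ∀ (L : Type) [Field L] [NumberField L] [IsCMField L] (v : HeightOneSpectrum (𝓞 ↥(maximalRealSubfield L))),
      (∀ w : PlacesOver L v, IsCMField.complexConj L • w.1 = w.1) →
      ∀ [MeasurableSpace (Gqs L v)] [BorelSpace (Gqs L v)]
        [∀ γ : Gqs L v, MeasurableSpace (Gqs L v ⧸ Subgroup.centralizer ({γ} : Set (Gqs L v)))]
        [∀ γ : Gqs L v, BorelSpace (Gqs L v ⧸ Subgroup.centralizer ({γ} : Set (Gqs L v)))]
        (νQv : Measure (Gqs L v)) [νQv.IsHaarMeasure] [νQv.IsMulRightInvariant]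
        (mQv : OrbitalMeasureFamily (Gqs L v)),
        mQv.IsCanonical (fun γ => IsRegularElt (γ.val : GL (Fin 3) (UnitaryGroup.LocalRing L v))) νQv →
        ∀ (T : Subgroup (Gqs L v)), IsCompact ((T : Subgroup (Gqs L v)) : Set (Gqs L v)) →
        ∀ (γ₀ : Gqs L v), IsRegularElt (γ₀.val : GL (Fin 3) (UnitaryGroup.LocalRing L v)) → T = Subgroup.centralizer ({γ₀} : Set (Gqs L v)) →
        (∀ γ ∈ T, IsRegularElt (γ.val : GL (Fin 3) (UnitaryGroup.LocalRing L v)) → ∀ c : UnitaryGroup.LocalRing L v, ¬ ((γ.val.val : Matrix (Fin 3) (Fin 3) (UnitaryGroup.LocalRing L v)).charpoly).IsRoot c) →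
        ∃ (S : Finset (ConjClasses (Gqs L v))) (mU : OrbitalMeasureFamily (Gqs L v)) (Γ : ConjClasses (Gqs L v) → ConjClasses (Gqs L v) → ℂ)
          (γseq : ℕ → Gqs L v) (q : ℂ) (a : ConjClasses (Gqs L v) → ℕ) (g : ConjClasses (Gqs L v) → ℂ) (n₀ : ℕ),
          (∀ u ∈ S, (((Quotient.out u : Gqs L v).val : GL (Fin 3) (UnitaryGroup.LocalRing L v)).val - 1) ^ 3 = 0) ∧
          mU.IsAdmissibleOn (fun γ : Gqs L v => (ConjClasses.mk γ) ∈ S) ∧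
          (∀ f : Gqs L v → ℂ, IsLocSmooth f →
            ∃ W ∈ 𝓝 (fun i : Fin 3 => ((1 : Matrix (Fin 3) (Fin 3) (UnitaryGroup.LocalRing L v)).charpoly).coeff i),
              ∀ c : ConjClasses (Gqs L v),
                IsRegularElt ((Quotient.out c : Gqs L v).val : GL (Fin 3) (UnitaryGroup.LocalRing L v)) →
                (fun i : Fin 3 => ((Quotient.out c : Gqs L v).val : GL (Fin 3) (UnitaryGroup.LocalRing L v)).val.charpoly.coeff i) ∈ W →
                  classOrbitalIntegral mQv f c = ∑ u ∈ S, classOrbitalIntegral mU f u * Γ u c) ∧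
          (∀ n, γseq n ∈ (T : Set (Gqs L v)) ∧ IsRegularElt ((γseq n).val : GL (Fin 3) (UnitaryGroup.LocalRing L v))) ∧
          Tendsto γseq atTop (𝓝 (1 : Gqs L v)) ∧ 1 < ‖q‖ ∧
          (∀ u ∈ S, u ≠ ConjClasses.mk 1 → 1 ≤ a u) ∧
          ∀ u ∈ S, u ≠ ConjClasses.mk 1 → ∀ n, n₀ ≤ n → Γ u (ConjClasses.mk (γseq n)) = q ^ (n * a u) * g u := by
  intro L _ _ _ v hns _ _ _ _ νQv _ _ mQv hcan T hT γ₀ hγ₀ hTγ₀ _hT3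
  -- the place above `v`, non-splitness as `Subsingleton`
  obtain ⟨w⟩ := PlacesOver.nonempty L v
  haveI : Algebra.IsQuadraticExtension ↥(maximalRealSubfield L) L := IsCMField.isQuadraticExtension L
  have hsub : Subsingleton (PlacesOver L v) :=
    PlacesOver.subsingleton_of_smul_eq (IsCMField.complexConj L) (IsCMField.complexConj_ne_one L) w (hns w)
  -- the Ψ-package at `(L, v)`
  obtain ⟨Ψ, U₀, q, a, hU1, hU2, hE, hZ, hR, hC, hTend, hS, hq, ha, hSC⟩ := hΨ L v hns
  -- the Howe expansion datum of the canonical family and its dual pieces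
  obtain ⟨S, mU, Γ, hunip, hadm, hrao, hgerm⟩ := UnitaryGroup.shalikaGermExpansionNonsplit_antidiagOne_three L v w hsub mQv hcan.isAdmissibleOn
  obtain ⟨φ, hφs, hφ1, hφ0⟩ := UnitaryGroup.exists_unipotentDualPieces_antidiagOne_nonsplit L v w hsub S mU hunip hadm hrao
  -- the conjugation-invariance of regularity (the `hP` of the canonical-evaluation lemma)
  have hP : ∀ g x : Gqs L v, IsRegularElt (g.val : GL (Fin 3) (UnitaryGroup.LocalRing L v)) →
      IsRegularElt ((x * g * x⁻¹ : Gqs L v).val : GL (Fin 3) (UnitaryGroup.LocalRing L v)) := fun g x hg => isRegularElt_conj L v g x hg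
  -- (G3) THE LOCAL HOMOGENEITY: for `γ ∈ U₀` regular, in the three neighbourhoods, `Γ u [Ψ γ] = q ^ a u * Γ u [γ]`
  have hWφ : ∀ u ∈ S, ∃ W ∈ 𝓝 (fun i : Fin 3 => ((1 : Matrix (Fin 3) (Fin 3) (UnitaryGroup.LocalRing L v)).charpoly).coeff i),
      ∀ c : ConjClasses (Gqs L v),
        IsRegularElt ((Quotient.out c : Gqs L v).val : GL (Fin 3) (UnitaryGroup.LocalRing L v)) →
        (fun i : Fin 3 => ((Quotient.out c : Gqs L v).val : GL (Fin 3) (UnitaryGroup.LocalRing L v)).val.charpoly.coeff i) ∈ W →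
          classOrbitalIntegral mQv (φ u) c = Γ u c := by
    intro u hu
    obtain ⟨W, hW, hexp⟩ := hgerm (φ u) (hφs u hu)
    refine ⟨W, hW, fun c hreg hcW => ?_⟩
    rw [hexp c hreg hcW]
    exact sum_mul_eq_single_of_dual S (fun u' => classOrbitalIntegral mU (φ u) u') (fun u' => Γ u' c) hu (hφ1 u hu)
      (fun u' hu' hne => hφ0 u' hu' u hu hne)
  have hWψ : ∀ u ∈ S, ∃ W ∈ 𝓝 (fun i : Fin 3 => ((1 : Matrix (Fin 3) (Fin 3) (UnitaryGroup.LocalRing L v)).charpoly).coeff i),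
      ∀ c : ConjClasses (Gqs L v),
        IsRegularElt ((Quotient.out c : Gqs L v).val : GL (Fin 3) (UnitaryGroup.LocalRing L v)) →
        (fun i : Fin 3 => ((Quotient.out c : Gqs L v).val : GL (Fin 3) (UnitaryGroup.LocalRing L v)).val.charpoly.coeff i) ∈ W →
          classOrbitalIntegral mQv (U₀.indicator (φ u ∘ Ψ)) c = q ^ (a u) * Γ u c := by
    intro u hu
    obtain ⟨W, hW, hexp⟩ := hgerm (U₀.indicator (φ u ∘ Ψ)) (hS (φ u) (hφs u hu))
    refine ⟨W, hW, fun c hreg hcW => ?_⟩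
    rw [hexp c hreg hcW]
    have hrow : ∀ u' ∈ S, classOrbitalIntegral mU (U₀.indicator (φ u ∘ Ψ)) u' = q ^ (a u') * classOrbitalIntegral mU (φ u) u' :=
      fun u' hu' => hSC S mU hunip hadm u' hu' (φ u) (hφs u hu)
    rw [Finset.sum_congr rfl (fun u' hu' => by rw [hrow u' hu'])]
    rw [Finset.sum_eq_single_of_mem u hu (fun u' hu' hne => by rw [hφ0 u' hu' u hu hne, mul_zero, zero_mul]), hφ1 u hu, mul_one]
  choose! Wφ hWφn hWφ using hWφ
  choose! Wψ hWψn hWψ using hWψ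
  -- the transport identity `Φ([Ψγ], φ) = Φ([γ], 1_{U₀}·(φ∘Ψ))` for `γ ∈ U₀` regular
  have htransport : ∀ γ ∈ U₀, IsRegularElt (γ.val : GL (Fin 3) (UnitaryGroup.LocalRing L v)) → ∀ F : Gqs L v → ℂ,
      classOrbitalIntegral mQv F (ConjClasses.mk (Ψ γ)) = classOrbitalIntegral mQv (U₀.indicator (F ∘ Ψ)) (ConjClasses.mk γ) := by
    intro γ hγU hγr F
    obtain ⟨hTc, ρ, hρH, hρI, hρ1⟩ := exists_isHaarMeasure_isInvInvariant_compactCore_eq_one_G L (qsForm L) (UnitaryGroup.antidiagOne_isHermitian L 3)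
      (UnitaryGroup.isUnit_antidiagOne_det L 3) v γ hγr
    haveI := hρH
    haveI := hρI
    have hTt : ∀ τ ∈ Subgroup.centralizer ({γ} : Set (Gqs L v)), τ * γ = γ * τ := fun τ hτ => Subgroup.mem_centralizer_singleton_iff.1 hτ
    have hTΨ : Subgroup.centralizer ({Ψ γ} : Set (Gqs L v)) = Subgroup.centralizer ({γ} : Set (Gqs L v)) := by
      ext z
      rw [Subgroup.mem_centralizer_singleton_iff, Subgroup.mem_centralizer_singleton_iff]
      exact ((hZ γ hγU z)).symm
    have hTtΨ : ∀ τ ∈ Subgroup.centralizer ({γ} : Set (Gqs L v)), τ * Ψ γ = Ψ γ * τ := fun τ hτ => (hZ γ hγU τ).1 (hTt τ hτ)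
    rw [hcan.classOrbitalIntegral_mk_eq_integral_descConj hP (hR γ hγU hγr) (Subgroup.centralizer ({γ} : Set (Gqs L v))) hTc hTΨ hTtΨ ρ hρ1 F,
      hcan.classOrbitalIntegral_mk_eq_integral_descConj hP hγr (Subgroup.centralizer ({γ} : Set (Gqs L v))) hTc rfl hTt ρ hρ1 (U₀.indicator (F ∘ Ψ))]
    refine integral_congr_ae (Eventually.of_forall fun y => ?_)
    induction y using QuotientGroup.induction_on with
    | H x =>
      rw [descConj_mk, descConj_mk, Set.indicator_of_mem (hU2 γ hγU x), Function.comp_apply, hE γ hγU x]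
  -- the local homogeneity along `U₀`
  set χ : Gqs L v → (Fin 3 → UnitaryGroup.LocalRing L v) :=
    fun γ i => (((γ.val : GL (Fin 3) (UnitaryGroup.LocalRing L v)).val : Matrix (Fin 3) (Fin 3) (UnitaryGroup.LocalRing L v)).charpoly).coeff i with hχdef
  have hχc : Continuous χ := by
    have h2 : Continuous fun γ : Gqs L v => ((γ.val : GL (Fin 3) (UnitaryGroup.LocalRing L v)).val : Matrix (Fin 3) (Fin 3) (UnitaryGroup.LocalRing L v)) :=
      Units.continuous_val.comp continuous_subtype_val
    exact continuous_pi fun i => (Literature.LinearAlgebra.Matrix.continuous_charpoly_coeff (i : ℕ)).comp h2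
  have h11 : ((1 : Gqs L v).val : GL (Fin 3) (UnitaryGroup.LocalRing L v)) = 1 := rfl
  have hχ1 : χ 1 = fun i : Fin 3 => ((1 : Matrix (Fin 3) (Fin 3) (UnitaryGroup.LocalRing L v)).charpoly).coeff i := by
    funext i
    simp only [hχdef, h11, Units.val_one]
  have hcoef : ∀ γ : Gqs L v, (fun i : Fin 3 => ((Quotient.out (ConjClasses.mk γ) : Gqs L v).val : GL (Fin 3) (UnitaryGroup.LocalRing L v)).val.charpoly.coeff i) = χ γ := by
    intro γ; funext i; simp only [hχdef, charpoly_out_mk]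
  -- the good set: `γ ∈ U₀`, `χ γ ∈ ⋂ Wψ u`, `χ (Ψ γ) ∈ ⋂ Wφ u`
  have hloc : ∀ γ ∈ U₀, IsRegularElt (γ.val : GL (Fin 3) (UnitaryGroup.LocalRing L v)) →
      (∀ u ∈ S, χ γ ∈ Wψ u) → (∀ u ∈ S, χ (Ψ γ) ∈ Wφ u) →
        ∀ u ∈ S, Γ u (ConjClasses.mk (Ψ γ)) = q ^ (a u) * Γ u (ConjClasses.mk γ) := by
    intro γ hγU hγr hγψ hγφ u hu
    have h1 := hWφ u hu (ConjClasses.mk (Ψ γ)) (isRegularElt_out_mk L v (hR γ hγU hγr)) (by rw [hcoef]; exact hγφ u hu)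
    have h2 := hWψ u hu (ConjClasses.mk γ) (isRegularElt_out_mk L v hγr) (by rw [hcoef]; exact hγψ u hu)
    rw [← h1, htransport γ hγU hγr (φ u), h2]
  -- the ray: a regular start in `T ∩ U₀`, deep enough
  obtain ⟨γseq, hγseq, hγseq1⟩ := compactCartanRegularRay L v hns T γ₀ hγ₀ hTγ₀
  have hevs : ∀ᶠ m in atTop, γseq m ∈ U₀ := hγseq1 hU1
  obtain ⟨m, hm⟩ := eventually_atTop.1 hevs
  set γs : Gqs L v := γseq m with hγsdef
  have hγsU : γs ∈ U₀ := hm m le_rfl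
  have hγsT : γs ∈ (T : Set (Gqs L v)) := (hγseq m).1
  have hγsr : IsRegularElt (γs.val : GL (Fin 3) (UnitaryGroup.LocalRing L v)) := (hγseq m).2
  -- iterates: in `U₀`, in `T`, regular
  have hitU : ∀ k, Ψ^[k] γs ∈ U₀ := fun k => iterate_mem hC hγsU k
  have hitT : ∀ k, Ψ^[k] γs ∈ (T : Set (Gqs L v)) := by
    intro k
    induction k with
    | zero => exact hγsT
    | succ k ih =>
      rw [Function.iterate_succ_apply']
      have hk : Ψ^[k] γs * γ₀ = γ₀ * Ψ^[k] γs := by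
        have h' := ih
        rw [hTγ₀, SetLike.mem_coe, Subgroup.mem_centralizer_singleton_iff] at h'
        exact h'
      rw [hTγ₀, SetLike.mem_coe, Subgroup.mem_centralizer_singleton_iff]
      exact ((hZ _ (hitU k) γ₀).1 hk.symm).symm
  have hitR : ∀ k, IsRegularElt ((Ψ^[k] γs).val : GL (Fin 3) (UnitaryGroup.LocalRing L v)) := by
    intro k
    induction k with
    | zero => exact hγsr
    | succ k ih => rw [Function.iterate_succ_apply']; exact hR _ (hitU k) ih
  have hitTend : Tendsto (fun k : ℕ => Ψ^[k] γs) atTop (𝓝 (1 : Gqs L v)) := hTend γs hγsU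
  -- deep enough: from `k₀` on, `χ (Ψ^[k] γs) ∈ Wψ u ∩ Wφ u` for every `u ∈ S`
  have hχt : Tendsto (fun k => χ (Ψ^[k] γs)) atTop (𝓝 (χ 1)) := (hχc.tendsto 1).comp hitTend
  have hev : ∀ᶠ k in atTop, ∀ u ∈ S, χ (Ψ^[k] γs) ∈ Wψ u ∩ Wφ u := by
    rw [eventually_all_finset]
    intro u hu
    exact hχt (by rw [hχ1]; exact inter_mem (hWψn u hu) (hWφn u hu))
  obtain ⟨k₀, hk₀⟩ := eventually_atTop.1 hev
  -- the data of ‹#3H*›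
  refine ⟨S, mU, Γ, fun n => Ψ^[n + k₀] γs, q, a, fun u => Γ u (ConjClasses.mk (Ψ^[k₀] γs)), 0, hunip, hadm, hgerm,
    fun n => ⟨hitT (n + k₀), hitR (n + k₀)⟩, hitTend.comp (tendsto_add_atTop_nat k₀), hq, fun u _ hne => ha u hne, fun u hu _ n _ => ?_⟩
  -- HOM along the ray: the geometric recursion
  have hstep : ∀ k, Γ u (ConjClasses.mk (Ψ^[(k + 1) + k₀] γs)) = q ^ (a u) * Γ u (ConjClasses.mk (Ψ^[k + k₀] γs)) := by
    intro k
    have e : Ψ^[(k + 1) + k₀] γs = Ψ (Ψ^[k + k₀] γs) := by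
      rw [show (k + 1) + k₀ = (k + k₀) + 1 by ring, Function.iterate_succ_apply']
    rw [e]
    refine hloc _ (hitU _) (hitR _) (fun u' hu' => (hk₀ (k + k₀) (Nat.le_add_left k₀ k) u' hu').1) (fun u' hu' => ?_) u hu
    have h' := (hk₀ ((k + k₀) + 1) (by omega) u' hu').2
    rwa [Function.iterate_succ_apply'] at h'
  have := eq_pow_mul_of_succ_eq_mul (s := fun k => Γ u (ConjClasses.mk (Ψ^[k + k₀] γs))) (r := q ^ (a u)) hstep n
  simp only [zero_add] at this
  rw [this, ← pow_mul, mul_comm (a u) n]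

end Summit.HodgeConjecture.HodgeConjecture.Cruxes.H413.K2E3ShalikaGermHomogeneityOfUnipotentScaling

end
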